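import Summits.ResolutionOfSingularities.ResolutionOfSingularities.Theorems.PlanarCutMoves
import Summits.ResolutionOfSingularities.ResolutionOfSingularities.Theorems.RadicialJungCleanModelsLens5UnimodularRefinement4
import HarnessLib

/-!
# PlanarCutWalks — decomp-res node «PlanarCut» (lens-5 g18 rev 1), tree file 4/5: WALK LEVEL — `PlanarFrom W k
N` (the walk respects
the wall `u_k` from time `N` on), the POTENTIAL (strict multiplicity of the wall layers), its descent at planar
proximity repeats, and THE
KILL `noPlanarTails` (rev 1 hypothesis: layer 0 of the wall empty at `N`, i.e. `u_k ∣ F_N`): no forced deep walk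
is boundary-planar along a
wall dividing `F_N` with proximity repeats AND translations infinitely often.  PROVED, hypothesis-free.

Content VERBATIM from the decomp-res lens-5 g18 file `HOME/decomp-res-lens-5/g18/parts/PlanarCut-REV1-155d4ffb.lean`
(sha256 155d4ffbaf2b8fc3; the REV1
pin the critic graded, CRITIC-LEDGER rows 119 + 119a CLEARED: DECIDED +1 · MAP +1; supersedes the NODE pin b3c721b9).  HOME =
run/shared/lean/pub/decomp-res.  Host: route `MaxContactCut`, aside 31770 `MaxContactCut.DefectWalksDeep` BY NAME
through the tree's
`ExitLaw.defectWalksDeep_iff_joint'` (`Theorems/MaxContactCutExitLaw`).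
(Sources: Hauser2010 §§D–G; HauserPerlega2019; CossartJannsenSaito2020 Thm. 2.14; CossartPiltant2019; Moh1987.)

[WRITER NOTE: the lens's `fin3_exists_ne` is the tree's
`RadicialJung.CleanModels.Lens5.UnimodularRefinement.fin3_other` (dedup), imported and used by name.]
-/

noncomputable section

open MvPolynomial Finset
open Literature.AlgebraicGeometry.Resolution
open Literature.AlgebraicGeometry.Resolution.Hauser2010
open Literature.AlgebraicGeometry.Resolution.PointBlowup
open Literature.AlgebraicGeometry.Resolution.WeightedBlowup
open Summit.ResolutionOfSingularities.ResolutionOfSingularities.Theses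
open Summit.ResolutionOfSingularities.ResolutionOfSingularities.Theorems.TightDefectClasses
open Summit.ResolutionOfSingularities.ResolutionOfSingularities.Theorems.TightDefectStrongWalks
open Summit.ResolutionOfSingularities.ResolutionOfSingularities.Theorems.ItineraryCutClasses
open Summit.ResolutionOfSingularities.ResolutionOfSingularities.Theorems.BoundaryLedger
open Summit.ResolutionOfSingularities.ResolutionOfSingularities.Theorems.ProximityCut
open Summit.ResolutionOfSingularities.ResolutionOfSingularities.Theorems.ExitLaw
open Summit.ResolutionOfSingularities.ResolutionOfSingularities.Theorems.RadicialJung.CleanModels.Lens5.UnimodularRefinement (fin3_other)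

namespace Summit.ResolutionOfSingularities.ResolutionOfSingularities.Theorems.PlanarCut

/-! ## §5 Walk level: the potential, its descent at planar proximity repeats, and the kill -/

section Walk

variable {K : Type} [Field K] [DecidableEq K] {q : ℕ} {s₀ : State (Fin 3) K}

/-- `PlanarFrom W k N`: from step `N` on the walk is BOUNDARY-PLANAR along the wall `u_k = 0` — it never uses the
chart `u_k` and never translates in `u_k`.  DEFINITION (the node's window). -/
def PlanarFrom (W : ForcedWalk q s₀) (k : Fin 3) (N : ℕ) : Prop :=
  ∀ t, N ≤ t → W.j t ≠ k ∧ W.b t k = 0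

/-- The POTENTIAL of the wall `u_k`: the total strict multiplicity of its layers `0 … q−1`.  DEFINITION (the node's
controlling quantity). -/
noncomputable def pot (W : ForcedWalk q s₀) (k i j : Fin 3) (t : ℕ) : ℕ :=
  ∑ a ∈ Finset.range q, sm (layer k a (W.st t).F) i j

/-- `st_succ_F`: Auxiliary step of this node's calculus, VERBATIM from the lens file (see the module docstring); the
statement is its type. [folklore] -/
theorem st_succ_F (W : ForcedWalk q s₀) (t : ℕ) : (W.st (t + 1)).F = (step q (W.j t) (W.b t) (W.st t)).F := by
  rw [W.st_succ]

/-- Along a planar tail the wall multiplicity `r_k` is kept. [folklore] -/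
theorem r_wall_eq (hs : IsRoot q s₀) (W : ForcedWalk q s₀) {k : Fin 3} {N : ℕ} (hP : PlanarFrom W k N) :
    ∀ t, N ≤ t → (W.st t).r k = (W.st N).r k := by
  intro t ht
  induction t, ht using Nat.le_induction with
  | base => rfl
  | succ t ht ih =>
    obtain ⟨o, ho, -⟩ := walk_nat hs W t
    rw [r_succ_eq W t ho, Finsupp.add_apply, kept_apply, if_pos ⟨(hP t ht).1.symm, (hP t ht).2⟩,
      Finsupp.single_eq_of_ne (hP t ht).1.symm, add_zero, ih]

/-- … so with `r_k ≥ 1` at the start, `u_k ∣ F_t`: the wall layer `0` is empty for all `t ≥ N`. [folklore] -/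
theorem layer_zero_eq_empty (hs : IsRoot q s₀) (W : ForcedWalk q s₀) {k : Fin 3} {N : ℕ} (hP : PlanarFrom W k N)
    (hr : 1 ≤ (W.st N).r k) {t : ℕ} (ht : N ≤ t) : layer k 0 (W.st t).F = ∅ := by
  apply Finset.eq_empty_of_forall_notMem
  intro d hd
  rw [mem_layer] at hd
  have h1 := Finsupp.le_def.mp (walk_r hs W t d (MvPolynomial.mem_support_iff.mpr hd.1)) k
  have h2 := r_wall_eq hs W hP t ht
  omega

variable {i j k : Fin 3} (hij : i ≠ j) (hjk : j ≠ k) (hik : i ≠ k)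
include hij hjk hik

/-- **THE WALL AS A COMPONENT (PROVED):** if `u_k ∣ F_N` (the wall layer `0` is empty at `N` — automatic when
`r_k ≥ 1`, `layer_zero_eq_empty`, but also possible for a ghost wall `r_k = 0`), then along a planar tail the wall
layer `0` stays empty for ever (`layer_step_eq_empty`).  Every walk-level law below is stated under this weaker
hypothesis; the `r_k ≥ 1` forms are corollaries. [new] [folklore] -/
theorem layer_zero_empty_of_planar (hs : IsRoot q s₀) (W : ForcedWalk q s₀) {N : ℕ} (hP : PlanarFrom W k N)
    (h0 : layer k 0 (W.st N).F = ∅) {t : ℕ} (ht : N ≤ t) : layer k 0 (W.st t).F = ∅ := by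
  induction t, ht using Nat.le_induction with
  | base => exact h0
  | succ t ht ih =>
    have hF : ∀ d ∈ (W.st t).F.support, q ≤ d.degree := fun d hd => le_degree_of_mem_support hs W t hd
    obtain ⟨hjk', hbk⟩ := hP t ht
    rw [st_succ_F]
    rcases fin3_cases ⟨hij, hjk, hik⟩ (W.j t) with h | h | h
    · rw [h]
      exact layer_step_eq_empty hij.symm hik hjk q (W.b t) (by rw [← h]; exact W.onExc t) hbk (W.st t) hF ih
    · rw [h]
      exact layer_step_eq_empty hij hjk hik q (W.b t) (by rw [← h]; exact W.onExc t) hbk (W.st t) hF ih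
    · exact absurd h hjk'

/-- Monotonicity along a planar tail, layer by layer. [new] [folklore] -/
theorem sm_succ_le (hs : IsRoot q s₀) (W : ForcedWalk q s₀) {N : ℕ} (hP : PlanarFrom W k N) {t : ℕ} (ht : N ≤ t)
    {a : ℕ} (ha1 : 1 ≤ a) (haq : a < q) : sm (layer k a (W.st (t + 1)).F) i j ≤ sm (layer k a (W.st t).F) i j := by
  have hF : ∀ d ∈ (W.st t).F.support, q ≤ d.degree := fun d hd => le_degree_of_mem_support hs W t hd
  obtain ⟨hjk', hbk⟩ := hP t ht
  rw [st_succ_F]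
  rcases fin3_cases ⟨hij, hjk, hik⟩ (W.j t) with h | h | h
  · rw [h, sm_comm, sm_comm (S := layer k a (W.st t).F)]
    exact sm_step_le hij.symm hik hjk q (W.b t) (by rw [← h]; exact W.onExc t) hbk (W.st t) hF ha1 haq
  · rw [h]
    exact sm_step_le hij hjk hik q (W.b t) (by rw [← h]; exact W.onExc t) hbk (W.st t) hF ha1 haq
  · exact absurd h hjk'

/-- The potential is non-increasing along a planar tail. [new] [folklore] -/
theorem pot_succ_le (hs : IsRoot q s₀) (W : ForcedWalk q s₀) {N : ℕ} (hP : PlanarFrom W k N)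
    (h0 : layer k 0 (W.st N).F = ∅) {t : ℕ} (ht : N ≤ t) : pot W k i j (t + 1) ≤ pot W k i j t := by
  unfold pot
  apply Finset.sum_le_sum
  intro a ha
  rw [Finset.mem_range] at ha
  rcases Nat.eq_zero_or_pos a with h0 | hpos
  · subst h0
    rw [layer_zero_empty_of_planar hij hjk hik hs W hP h0 (by omega : N ≤ t + 1), layer_zero_empty_of_planar hij hjk hik hs W hP h0 ht]
  · exact sm_succ_le hij hjk hik hs W hP ht hpos ha

/-- `pot_mono`: Auxiliary step of this node's calculus, VERBATIM from the lens file (see the module docstring); the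
statement is its type. [folklore] -/
theorem pot_mono (hs : IsRoot q s₀) (W : ForcedWalk q s₀) {N : ℕ} (hP : PlanarFrom W k N)
    (h0 : layer k 0 (W.st N).F = ∅) {t t' : ℕ} (ht : N ≤ t) (htt' : t ≤ t') : pot W k i j t' ≤ pot W k i j t := by
  induction t', htt' using Nat.le_induction with
  | base => exact le_rfl
  | succ t' htt' ih => exact (pot_succ_le hij hjk hik hs W hP h0 (by omega)).trans ih

/-- **DESCENT AT A PLANAR PROXIMITY REPEAT (PROVED):** `pot (t+2) + pot (t+1) ≤ pot t` when step `t+1` stays on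
the newest divisor. [new] [folklore] -/
theorem pot_succ_succ_le (hs : IsRoot q s₀) (W : ForcedWalk q s₀) {N : ℕ} (hP : PlanarFrom W k N)
    (h0 : layer k 0 (W.st N).F = ∅) {t : ℕ} (ht : N ≤ t) (hS : StaysOnNewest W t) :
    pot W k i j (t + 2) + pot W k i j (t + 1) ≤ pot W k i j t := by
  classical
  have hF : ∀ d ∈ (W.st t).F.support, q ≤ d.degree := fun d hd => le_degree_of_mem_support hs W t hd
  have hF' : ∀ d ∈ (step q (W.j t) (W.b t) (W.st t)).F.support, q ≤ d.degree := by
    intro d hd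
    rw [← st_succ_F] at hd
    exact le_degree_of_mem_support hs W (t + 1) hd
  obtain ⟨hjk0, hbk0⟩ := hP t ht
  obtain ⟨hjk1, hbk1⟩ := hP (t + 1) (by omega)
  obtain ⟨hne, hbS⟩ := hS
  have hb1 : W.b (t + 1) = 0 := by
    funext l
    rcases fin3_cases ⟨hne, hjk0, hjk1⟩ l with rfl | rfl | rfl
    · exact W.onExc (t + 1)
    · exact hbS
    · exact hbk1
  have h2 : (W.st (t + 2)).F = (step q (W.j (t + 1)) 0 (step q (W.j t) (W.b t) (W.st t))).F := by
    rw [← hb1, ← W.st_succ t, ← W.st_succ (t + 1)]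
  unfold pot
  rw [← Finset.sum_add_distrib]
  apply Finset.sum_le_sum
  intro a ha
  rw [Finset.mem_range] at ha
  rcases Nat.eq_zero_or_pos a with h0 | hpos
  · subst h0
    rw [layer_zero_empty_of_planar hij hjk hik hs W hP h0 (by omega : N ≤ t + 2), layer_zero_empty_of_planar hij hjk hik hs W hP h0 (by omega : N ≤ t + 1),
      layer_zero_empty_of_planar hij hjk hik hs W hP h0 ht, sm_empty]
  · rw [h2, st_succ_F W t]
    rcases fin3_cases ⟨hij, hjk, hik⟩ (W.j t) with h | h | h
    · -- chart `u_i` then `u_j`: roles `(j, i, k)`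
      have h1 : W.j (t + 1) = j := by
        rcases fin3_cases ⟨hij, hjk, hik⟩ (W.j (t + 1)) with h' | h' | h'
        · exact absurd (h'.trans h.symm) hne
        · exact h'
        · exact absurd h' hjk1
      rw [h, h1, sm_comm, sm_comm (S := layer k a (step q i (W.b t) (W.st t)).F),
        sm_comm (S := layer k a (W.st t).F)]
      rw [h] at hF'
      exact sm_step_step_le hij.symm hik hjk q (W.b t) (by rw [← h]; exact W.onExc t) hbk0 (W.st t) hF hF' hpos ha
    · have h1 : W.j (t + 1) = i := by
        rcases fin3_cases ⟨hij, hjk, hik⟩ (W.j (t + 1)) with h' | h' | h'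
        · exact h'
        · exact absurd (h'.trans h.symm) hne
        · exact absurd h' hjk1
      rw [h, h1]
      rw [h] at hF'
      exact sm_step_step_le hij hjk hik q (W.b t) (by rw [← h]; exact W.onExc t) hbk0 (W.st t) hF hF' hpos ha
    · exact absurd h hjk0

/-- **THE POTENTIAL DIES (PROVED):** infinitely many proximity repeats on a planar tail force `pot T = 0` for some
`T ≥ N` (each repeat at least halves it). [new] [folklore] -/
theorem exists_pot_eq_zero (hs : IsRoot q s₀) (W : ForcedWalk q s₀) {N : ℕ} (hP : PlanarFrom W k N)
    (h0 : layer k 0 (W.st N).F = ∅) (hSio : ∀ M : ℕ, ∃ t, M ≤ t ∧ StaysOnNewest W t) :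
    ∃ T, N ≤ T ∧ pot W k i j T = 0 := by
  suffices h : ∀ n t, N ≤ t → pot W k i j t ≤ n → ∃ T, N ≤ T ∧ pot W k i j T = 0 from h _ N le_rfl le_rfl
  intro n
  induction n using Nat.strong_induction_on with
  | _ n ih =>
    intro t ht hle
    rcases Nat.eq_zero_or_pos (pot W k i j t) with h0 | hpos
    · exact ⟨t, ht, h0⟩
    · obtain ⟨t', htt', hS⟩ := hSio t
      have h1 := pot_mono hij hjk hik hs W hP h0 ht htt'
      have h2 := pot_succ_succ_le hij hjk hik hs W hP h0 (le_trans ht htt') hS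
      have h3 : pot W k i j (t' + 2) ≤ pot W k i j (t' + 1) :=
        pot_succ_le hij hjk hik hs W hP h0 (by omega : N ≤ t' + 1)
      exact ih (pot W k i j (t' + 2)) (by omega) (t' + 2) (by omega) le_rfl

/-- After the potential has died every wall layer `1 … q−1` is monomial-led, for ever. [new] [folklore] -/
theorem sm_eq_zero_of_late (hs : IsRoot q s₀) (W : ForcedWalk q s₀) {N : ℕ} (hP : PlanarFrom W k N)
    (h0 : layer k 0 (W.st N).F = ∅) {T : ℕ} (hT : N ≤ T) (hpot : pot W k i j T = 0) {t : ℕ} (ht : T ≤ t)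
    {a : ℕ} (haq : a < q) : sm (layer k a (W.st t).F) i j = 0 := by
  have h1 := pot_mono hij hjk hik hs W hP h0 hT ht
  rw [hpot, Nat.le_zero] at h1
  exact Finset.sum_eq_zero_iff.mp h1 a (Finset.mem_range.mpr haq)

/-- **HALVING (PROVED):** across a proximity repeat inside a planar tail the potential at least halves:
`2 · pot (t+2) ≤ pot t`. [new] [folklore] -/
theorem two_mul_pot_le (hs : IsRoot q s₀) (W : ForcedWalk q s₀) {N : ℕ} (hP : PlanarFrom W k N)
    (h0 : layer k 0 (W.st N).F = ∅) {t : ℕ} (ht : N ≤ t) (hS : StaysOnNewest W t) :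
    2 * pot W k i j (t + 2) ≤ pot W k i j t := by
  have h1 := pot_succ_succ_le hij hjk hik hs W hP h0 ht hS
  have h2 : pot W k i j (t + 2) ≤ pot W k i j (t + 1) :=
    pot_succ_le hij hjk hik hs W hP h0 (by omega : N ≤ t + 1)
  omega

/-- **THE FINITE RANGE (PROVED, effective):** `m` proximity repeats at times `τ 0, …, τ (m−1)` of a planar tail,
consecutive ones at least two steps apart, divide the potential by `2^m`: `2^m · pot (τ m) ≤ pot N`. [new] [folklore] -/
theorem pow_mul_pot_le (hs : IsRoot q s₀) (W : ForcedWalk q s₀) {N : ℕ} (hP : PlanarFrom W k N)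
    (h0 : layer k 0 (W.st N).F = ∅) (τ : ℕ → ℕ) (hτN : N ≤ τ 0) (hτ : ∀ l, τ l + 2 ≤ τ (l + 1)) :
    ∀ m : ℕ, (∀ l, l < m → StaysOnNewest W (τ l)) → 2 ^ m * pot W k i j (τ m) ≤ pot W k i j N := by
  have hmono : ∀ l, N ≤ τ l := by
    intro l
    induction l with
    | zero => exact hτN
    | succ l ih => exact le_trans ih (by have := hτ l; omega)
  intro m
  induction m with
  | zero =>
    intro _
    rw [pow_zero, one_mul]
    exact pot_mono hij hjk hik hs W hP h0 le_rfl hτN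
  | succ m ih =>
    intro hSm
    have h1 := ih fun l hl => hSm l (by omega)
    have h2 := two_mul_pot_le hij hjk hik hs W hP h0 (hmono m) (hSm m (by omega))
    have h3 : pot W k i j (τ (m + 1)) ≤ pot W k i j (τ m + 2) :=
      pot_mono hij hjk hik hs W hP h0 (by have := hmono m; omega) (hτ m)
    calc 2 ^ (m + 1) * pot W k i j (τ (m + 1)) = 2 ^ m * (2 * pot W k i j (τ (m + 1))) := by ring
      _ ≤ 2 ^ m * pot W k i j (τ m) := Nat.mul_le_mul_left _ (le_trans (Nat.mul_le_mul_left _ h3) h2)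
      _ ≤ pot W k i j N := h1

/-- **DEAD POTENTIAL ⇒ NO MORE TRANSLATIONS (PROVED, the finite form of the law):** once the wall potential has
died (`pot T = 0`, `T ≥ N`), every later move of the planar tail is UNTRANSLATED — a translated planar move from a state
all of whose wall layers are monomial-led produces a state fat off the translation axis, which is not isolated.
[new] [folklore] -/
theorem b_eq_zero_of_dead (hs : IsRoot q s₀) (W : ForcedWalk q s₀) {N : ℕ} (hP : PlanarFrom W k N)
    (h0 : layer k 0 (W.st N).F = ∅) {T : ℕ} (hNT : N ≤ T) (hpot : pot W k i j T = 0) {t : ℕ} (hTt : T ≤ t) : W.b t = 0 := by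
  classical
  by_contra hbt
  have ht : N ≤ t := le_trans hNT hTt
  have hF : ∀ d ∈ (W.st t).F.support, q ≤ d.degree := fun d hd => le_degree_of_mem_support hs W t hd
  have hF' : ∀ d ∈ (step q (W.j t) (W.b t) (W.st t)).F.support, q ≤ d.degree := by
    intro d hd
    rw [← st_succ_F] at hd
    exact le_degree_of_mem_support hs W (t + 1) hd
  have h0t : layer k 0 (W.st t).F = ∅ := layer_zero_empty_of_planar hij hjk hik hs W hP h0 ht
  have hdead : ∀ a, 1 ≤ a → a < q → sm (layer k a (W.st t).F) i j = 0 :=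
    fun a _ haq => sm_eq_zero_of_late hij hjk hik hs W hP h0 hNT hpot hTt haq
  obtain ⟨hjk0, hbk0⟩ := hP t ht
  have hiso := W.isolated (t + 1)
  rw [st_succ_F] at hiso
  rcases fin3_cases ⟨hij, hjk, hik⟩ (W.j t) with h | h | h
  · -- chart `u_i`, translation in `u_j`: roles `(j, i, k)`
    have hbj : W.b t j ≠ 0 := by
      intro hbj
      apply hbt
      funext l
      rcases fin3_cases ⟨hij, hjk, hik⟩ l with rfl | rfl | rfl
      · rw [← h]; exact W.onExc t
      · exact hbj
      · exact hbk0
    rw [h] at hF' hiso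
    refine not_isolatedTop_of_fat q j _ (fat_of_dead_layers hij.symm hik hjk q (W.b t)
      (by rw [← h]; exact W.onExc t) hbk0 hbj (W.st t) hF hF' h0t ?_) hiso
    intro a ha1 haq
    rw [sm_comm]
    exact hdead a ha1 haq
  · have hbi : W.b t i ≠ 0 := by
      intro hbi
      apply hbt
      funext l
      rcases fin3_cases ⟨hij, hjk, hik⟩ l with rfl | rfl | rfl
      · exact hbi
      · rw [← h]; exact W.onExc t
      · exact hbk0
    rw [h] at hF' hiso
    exact not_isolatedTop_of_fat q i _ (fat_of_dead_layers hij hjk hik q (W.b t)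
      (by rw [← h]; exact W.onExc t) hbk0 hbi (W.st t) hF hF' h0t hdead) hiso
  · exact absurd h hjk0

/-- **THE EFFECTIVE WINDOW (PROVED):** if a planar tail shows `m` proximity repeats (pairwise two steps apart) and a
TRANSLATED move after them, then `2^m ≤ pot N` — at most `⌊log₂ pot_N⌋` spaced repeats of a boundary-planar tail are
followed by a translation.  This is the finite range of the lens: the base range is `pot_N`, a number read off `F_N`.
[new] [folklore] -/
theorem pow_le_pot_of_translated (hs : IsRoot q s₀) (W : ForcedWalk q s₀) {N : ℕ} (hP : PlanarFrom W k N)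
    (h0 : layer k 0 (W.st N).F = ∅) (τ : ℕ → ℕ) (hτN : N ≤ τ 0) (hτ : ∀ l, τ l + 2 ≤ τ (l + 1)) (m : ℕ)
    (hSm : ∀ l, l < m → StaysOnNewest W (τ l)) {t : ℕ} (ht : τ m ≤ t) (hbt : W.b t ≠ 0) :
    2 ^ m ≤ pot W k i j N := by
  have hmono : ∀ l, N ≤ τ l := by
    intro l
    induction l with
    | zero => exact hτN
    | succ l ih => exact le_trans ih (by have := hτ l; omega)
  have h1 := pow_mul_pot_le hij hjk hik hs W hP h0 τ hτN hτ m hSm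
  rcases Nat.eq_zero_or_pos (pot W k i j (τ m)) with hz | hpos
  · exact absurd (b_eq_zero_of_dead hij hjk hik hs W hP h0 (hmono m) hz ht) hbt
  · calc 2 ^ m = 2 ^ m * 1 := (mul_one _).symm
      _ ≤ 2 ^ m * pot W k i j (τ m) := Nat.mul_le_mul_left _ hpos
      _ ≤ pot W k i j N := h1

omit hij hjk hik in
/-- **THE PLANAR PROXIMITY LAW, COMPONENT FORM (PROVED, hypothesis-free, every `q`, every field):** no forced walk
from a root has a planar tail along a wall `u_k` DIVIDING `F_N` (never the chart `u_k`, never a `u_k`-translation from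
`N` on) with infinitely many proximity repeats AND infinitely many translated moves.  Proof: the wall potential dies
at the repeats (`exists_pot_eq_zero`); after that no move translates (`b_eq_zero_of_dead`). [new] [folklore] -/
theorem noPlanarTails_of_layer_zero (hs : IsRoot q s₀) (W : ForcedWalk q s₀) (k : Fin 3) (N : ℕ)
    (hP : PlanarFrom W k N) (h0 : layer k 0 (W.st N).F = ∅) (hSio : ∀ M : ℕ, ∃ t, M ≤ t ∧ StaysOnNewest W t)
    (hb : ∀ M : ℕ, ∃ t, M ≤ t ∧ W.b t ≠ 0) : False := by
  classical
  obtain ⟨j, hjk⟩ := fin3_other k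
  obtain ⟨i, hij, hik⟩ := fin3_third j k hjk
  obtain ⟨T, hNT, hpot⟩ := exists_pot_eq_zero hij hjk hik hs W hP h0 hSio
  obtain ⟨t, hTt, hbt⟩ := hb T
  exact hbt (b_eq_zero_of_dead hij hjk hik hs W hP h0 hNT hpot hTt)

omit hij hjk hik in
/-- **THE PLANAR PROXIMITY LAW (PROVED, hypothesis-free, every `q`, every field):** no forced walk from a root has a
BOUNDARY-PLANAR tail (wall `u_k = 0` of positive multiplicity; never the chart `u_k`, never a `u_k`-translation) with
infinitely many proximity repeats AND infinitely many translated moves (`r_k ≥ 1` gives `u_k ∣ F_N`). [new] [folklore] -/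
theorem noPlanarTails (hs : IsRoot q s₀) (W : ForcedWalk q s₀) (k : Fin 3) (N : ℕ) (hP : PlanarFrom W k N)
    (hr : 1 ≤ (W.st N).r k) (hSio : ∀ M : ℕ, ∃ t, M ≤ t ∧ StaysOnNewest W t)
    (hb : ∀ M : ℕ, ∃ t, M ≤ t ∧ W.b t ≠ 0) : False :=
  noPlanarTails_of_layer_zero hs W k N hP (layer_zero_eq_empty hs W hP hr le_rfl) hSio hb

omit [DecidableEq K] hij hjk hik in
/-- Layer `0` of the wall `u_k` is empty iff `u_k ∣ F` monomialwise: every exponent has `d_k ≥ 1`. [folklore] -/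
theorem layer_zero_eq_empty_iff (k : Fin 3) (F : MvPolynomial (Fin 3) K) :
    layer k 0 F = ∅ ↔ ∀ d ∈ F.support, 1 ≤ d k := by
  classical
  constructor
  · intro h d hd
    by_contra hlt
    have : d ∈ layer k 0 F := mem_layer.mpr ⟨MvPolynomial.mem_support_iff.mp hd, by omega⟩
    rw [h] at this
    exact absurd this (Finset.notMem_empty d)
  · intro h
    apply Finset.eq_empty_of_forall_notMem
    intro d hd
    rw [mem_layer] at hd
    have := h d (MvPolynomial.mem_support_iff.mpr hd.1)
    omega

omit hij hjk hik in
/-- **PROFILE OF THE RESIDUAL (PROVED): every wall is left again.**  On a tail with proximity repeats i.o. and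
translated moves i.o., after every excess move `t ≥ N` (`o_t ≠ q`) the walk later USES the chart `u_{j_t}` or
TRANSLATES along `u_{j_t}`: the wall `u_{j_t} = 0` created at `t` (multiplicity `o_t − q ≥ 1`, tree
`BoundaryLedger.r_succ_eq`) is never respected for ever. [new] [folklore] -/
theorem exits_every_wall (hs : IsRoot q s₀) (W : ForcedWalk q s₀) {N : ℕ}
    (hexc : ∀ t, N ≤ t → ordZero (W.st t).F ≠ (q : ℕ∞))
    (hSio : ∀ M : ℕ, ∃ t, M ≤ t ∧ StaysOnNewest W t) (hb : ∀ M : ℕ, ∃ t, M ≤ t ∧ W.b t ≠ 0)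
    {t : ℕ} (ht : N ≤ t) : ∃ t', t < t' ∧ (W.j t' = W.j t ∨ W.b t' (W.j t) ≠ 0) := by
  classical
  by_contra h
  push Not at h
  have hP : PlanarFrom W (W.j t) (t + 1) := fun t' ht' => h t' (by omega)
  obtain ⟨o, ho, hqo⟩ := walk_nat hs W t
  have hoq : o ≠ q := fun h' => hexc t ht (by rw [ho, h'])
  have h1 : 1 ≤ o - q := by omega
  have hr : 1 ≤ (W.st (t + 1)).r (W.j t) := by
    rw [r_succ_eq W t ho, Finsupp.add_apply, Finsupp.single_eq_same]
    exact le_add_left h1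
  exact noPlanarTails hs W (W.j t) (t + 1) hP hr hSio hb

end Walk

end Summit.ResolutionOfSingularities.ResolutionOfSingularities.Theorems.PlanarCut
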